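import Mathlib
import Literature.MathematicalPhysics.QuantumFieldTheory.Balaban1983to89.B9Thm311Lattice
import Literature.MathematicalPhysics.QuantumFieldTheory.Balaban1983to89.B8Eq194FirstTerm
import Literature.MathematicalPhysics.QuantumFieldTheory.Balaban1983to89.B8Eq194Criterion

/-!
# [B8] (1.91) vs [4] (3.163): the criterion Q′ΔN(Q′) = 0 on the cell's (3.25)-lattice carriers
# (cell GAPS G-B8-19 (c), part 4: dictionary `B9Thm311Lattice` (flat background, scalar fibre) ↔ `B8Eq194Criterion`)

statement-level skeleton of published theorems with citation tags; proofs where landed; nothing here is a claim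
about the Yang–Mills mass gap

Seat p40 gen 8, Phase 2, B8 lane; fourth file of G-B8-19 (c) (parts 1–3: `B8Eq194Criterion` — characterization
`crit_iff`, read its CONTEXT / ERRATUM / HONEST SCOPE first —, `B8Eq194CriterionTorus`, `B8Eq194CriterionDirichlet`).
Kind: located reading note / dictionary, constants only — NOT an error of either paper.

WHY.  Parts 1–3 classify the criterion for the scalar-model Laplacian `B8Eq194Criterion.lap w m` and block sums
`blockSum`, whereas gen 7's `B8Eq194FirstTerm` (criterion ⟺ H′_{(1.91)} = H′_{(4)}, `H4_eq_Hp_of_criterion` /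
`criterion_of_H4_eq_Hp`) and r05's `B8Eq191Hprime.HpL` live over the (3.25)-`Data` of `B9Eq325Proj` on the ℓ²
LATTICE CARRIERS of `B9Thm311Lattice` (E = PiLp 2 (X → V), Q′ = `qL τ w B Γ y` of (3.19) with transports along
contours, Δ = `lapL τ bonds cb` = D†D of (3.23)).  This file identifies the two in the flat scalar case, so that the
classification applies to those `Data` verbatim.

CONTENT (X = sites, Y = unit-lattice points, both finite; V = ℝ; `flatT X` = all bond transports the identity):
* `pathTr_flatT` (contour transports are the identity), `qL_flat_apply` ((Q′f)(c) = Σ_{x∈B(c)} w(c,x) f(x)),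
  `qL_flat_blocks_apply` / **`qL_flat_eq_zero_iff`** — for the blocks `blocksOf blk` of a block map with uniform
  weights κ ≠ 0 (print: κ = L^{−d}): Q′f = 0 ⟺ `InKer blk f` (N(Q′) of (3.21) = the N(Q′) of part 1);
* **`lapL_flat_apply`** — (Δf)(x) = `lap (wOf bonds cb) 0 f x`: D†D of (3.23) is, pointwise, the graph Laplacian
  with the symmetrised bond weights `wOf` (c_{(x,z)} + c_{(z,x)}) and NO diagonal term (the cell's lattice carries
  only the bonds inside Ω₀, i.e. free boundary; [4]'s Dirichlet ∂Ω₀-bonds would be extra diagonal weight, part 3);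
* **`criterion_flat_iff`** — gen 7's criterion «∀ λ, Q′λ = 0 → Q′Δλ = 0» on these carriers ⟺
  `Crit (wOf bonds cb) 0 blk`; hence, for ANY (3.25)-data over them with a onto, **`H4_eq_Hp_iff_crit`**:
  H′_{(4)} = H′_{(1.91)} ⟺ `Crit (wOf bonds cb) 0 blk`, and **`exists_Hp_ne_H4_of_not_crit`**: if the criterion
  fails, (1.91)'s H′ differs from [4]'s (3.163) for every such data — data which EXIST for every block system
  (`exists_data_flat` = `B9Thm311Lattice.obvious_311_lattice` at τ = id, a_c > 0, c_b > 0; `AL_surjective`).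
With part 1's `crit_iff` this turns the six-site WITNESS of `B8Eq194FirstTerm.Witness6` into a THEOREM over the
cell's lattice carriers: H′_{(1.91)} = H′_{(4)} exactly when every coefficient vector of `wOf bonds cb` is
block-constant — e.g. never on a periodic chain/torus with L ≥ 3 (part 2), always when no bond joins two blocks.

HONEST SCOPE.  (i) Flat background and scalar fibre only (τ = id on V = ℝ); uniform block weights κ (the print's
L^{−d}); blocks given by a block MAP (a partition) — (3.18)'s `B : Y → Finset X` in `IsBlockSystem` need not be a
partition in general.  (ii) The identification of a concrete bond set (box, torus) with part 2/3's `piW`/`cycW`/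
`pathW` weights is NOT made here (it is an equality of weight functions, left to the consumer); the Dirichlet term of
part 3 has no counterpart on these carriers (free boundary).  (iii) No bound, no row head changes.

Sources: [Balaban1985RegularSpaces] (1.91) p. 91 [PDF 17]; [Balaban1985BackgroundPropagators] (3.18)–(3.19) p. 393,
(3.21)–(3.25) p. 394, (3.162)–(3.165) p. 429 [PDF 5, 6, 41] (OCR pages p0005, p0006, p0041 of
`paper:balaban1985-cmp99-background-propagators`).
-/

namespace Literature.MathematicalPhysics.QuantumFieldTheory.Balaban1983to89.B8Eq194CriterionLattice

open Finset B9Eq323Ker B9Eq319Onto B9Thm311Lattice B9Eq325Proj B9Thm311Data B8Eq191Hprime B8Eq194FirstTerm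
  B8Eq194Criterion
open scoped InnerProductSpace

noncomputable section

variable {X Y : Type*}

/-! ## §1  Flat transports on the scalar fibre: Q′ and N(Q′) -/

/-- Flat background, scalar fibre 𝔤 = ℝ: every bond transport R(U(b)) is the identity of V = ℝ.
[cite: Balaban1985BackgroundPropagators, (3.19) p. 393, (3.23) p. 394] -/
abbrev flatT (X : Type*) : X → X → ℝ →ₗ[ℝ] ℝ := fun _ _ => LinearMap.id

/-- Along any contour the flat scalar transport is the identity. [cite: Balaban1985BackgroundPropagators, (3.19) p. 393] -/
theorem pathTr_flatT : ∀ p : List X, pathTr (flatT X) p = LinearMap.id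
  | [] => rfl
  | [_] => rfl
  | x :: x' :: rest => by
    rw [pathTr_cons_cons, pathTr_flatT (x' :: rest)]
    rfl

/-- The flat scalar transports are injective (hypothesis `hinj` of `B9Thm311Lattice`).
[cite: Balaban1985BackgroundPropagators, (3.19) p. 393] -/
theorem flatT_injective (x x' : X) : Function.Injective (flatT X x x') := fun _ _ h => h

variable [Fintype X] [DecidableEq Y]

omit [Fintype X] [DecidableEq Y] in
/-- (3.19) with flat scalar transports: (Q′f)(c) = Σ_{x ∈ B(c)} w(c,x) f(x).
[cite: Balaban1985BackgroundPropagators, (3.19) p. 393] -/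
theorem qL_flat_apply (w : Y → X → ℝ) (B : Y → Finset X) (Γ : Y → X → List X) (y : Y → X)
    (f : PiLp 2 (fun _ : X => ℝ)) (c : Y) :
    qL (flatT X) w B Γ y f c = ∑ x ∈ B c, w c x * WithLp.ofLp f x := by
  rw [qL_apply]
  unfold avgQ
  refine Finset.sum_congr rfl fun x _ => ?_
  rw [pathTr_flatT]
  rfl

/-- The blocks of a block MAP blk : X → Y (a partition of the sites), as the `B : Y → Finset X` of (3.18)–(3.19).
[cite: Balaban1985BackgroundPropagators, (3.18)–(3.19) p. 393] -/
def blocksOf (blk : X → Y) : Y → Finset X := fun c => univ.filter fun x => blk x = c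

/-- With uniform weights κ (print: κ = L^{−d}) on the blocks of a block map: (Q′f)(c) = κ · (block sum of f over c).
[cite: Balaban1985BackgroundPropagators, (3.19) p. 393] -/
theorem qL_flat_blocks_apply (blk : X → Y) (κ : ℝ) (Γ : Y → X → List X) (y : Y → X)
    (f : PiLp 2 (fun _ : X => ℝ)) (c : Y) :
    qL (flatT X) (fun _ _ => κ) (blocksOf blk) Γ y f c = κ * blockSum blk (WithLp.ofLp f) c := by
  rw [qL_flat_apply, blockSum, Finset.mul_sum]
  rfl

/-- Hence N(Q′) of (3.21) on these carriers is `B8Eq194Criterion.InKer` (κ ≠ 0).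
[cite: Balaban1985BackgroundPropagators, (3.21) p. 394] -/
theorem qL_flat_eq_zero_iff (blk : X → Y) {κ : ℝ} (hκ : κ ≠ 0) (Γ : Y → X → List X) (y : Y → X)
    (f : PiLp 2 (fun _ : X => ℝ)) :
    qL (flatT X) (fun _ _ => κ) (blocksOf blk) Γ y f = 0 ↔ InKer blk (WithLp.ofLp f) := by
  constructor
  · intro h c
    have hc := congrArg (fun v : PiLp 2 (fun _ : Y => ℝ) => v c) h
    simp only at hc
    rw [qL_flat_blocks_apply] at hc
    exact (mul_eq_zero.1 hc).resolve_left hκ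
  · intro h
    ext c
    rw [qL_flat_blocks_apply, h c, mul_zero]
    rfl

/-! ## §2  Δ = D†D of (3.23), flat scalar case, pointwise -/

variable [DecidableEq X]

/-- The symmetrised bond weights of a weighted bond set: w(x,z) = c_{(x,z)} + c_{(z,x)} (each if present).
[cite: Balaban1985BackgroundPropagators, (3.23) p. 394] -/
def wOf (bonds : Finset (X × X)) (cb : X × X → ℝ) (x z : X) : ℝ :=
  (if (x, z) ∈ bonds then cb (x, z) else 0) + (if (z, x) ∈ bonds then cb (z, x) else 0)

omit [Fintype X] [DecidableEq Y] [DecidableEq X] in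
/-- helper: the flat scalar covariant derivative is the plain difference. [folklore] -/
private theorem covD_flatT (l : X → ℝ) (x x' : X) : covD (flatT X) l x x' = l x' - l x := rfl

/-- helper: a sum over the bonds starting at x, as a sum over sites. [folklore] -/
private theorem sum_bonds_fst (bonds : Finset (X × X)) (g : X × X → ℝ) (x : X) :
    ∑ b ∈ bonds, (if b.1 = x then g b else 0) = ∑ z, if (x, z) ∈ bonds then g (x, z) else 0 := by
  rw [← Finset.sum_filter, ← Finset.sum_filter]
  have himg : bonds.filter (fun b => b.1 = x) = (univ.filter fun z => (x, z) ∈ bonds).image (Prod.mk x) := by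
    ext ⟨b1, b2⟩
    simp only [mem_filter, mem_image, mem_univ, true_and, Prod.mk.injEq]
    constructor
    · rintro ⟨hb, rfl⟩; exact ⟨b2, hb, rfl, rfl⟩
    · rintro ⟨z, hz, rfl, rfl⟩; exact ⟨hz, rfl⟩
  rw [himg, Finset.sum_image fun z _ z' _ h => (Prod.mk.inj h).2]

/-- helper: a sum over the bonds ending at x, as a sum over sites. [folklore] -/
private theorem sum_bonds_snd (bonds : Finset (X × X)) (g : X × X → ℝ) (x : X) :
    ∑ b ∈ bonds, (if b.2 = x then g b else 0) = ∑ z, if (z, x) ∈ bonds then g (z, x) else 0 := by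
  rw [← Finset.sum_filter, ← Finset.sum_filter]
  have himg : bonds.filter (fun b => b.2 = x)
      = (univ.filter fun z => (z, x) ∈ bonds).image (fun z => (z, x)) := by
    ext ⟨b1, b2⟩
    simp only [mem_filter, mem_image, mem_univ, true_and, Prod.mk.injEq]
    constructor
    · rintro ⟨hb, rfl⟩; exact ⟨b1, hb, rfl, rfl⟩
    · rintro ⟨z, hz, rfl, rfl⟩; exact ⟨hz, rfl⟩
  rw [himg, Finset.sum_image fun z _ z' _ h => (Prod.mk.inj h).1]

/-- **Δ of (3.23) = D†D, flat scalar case, pointwise**: (Δf)(x) = Σ_z (c_{(x,z)} + c_{(z,x)}) (f(x) − f(z)) =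
`B8Eq194Criterion.lap (wOf bonds cb) 0 f x` — the graph Laplacian of the weighted bond set, no diagonal term.
[cite: Balaban1985BackgroundPropagators, (3.23) p. 394] -/
theorem lapL_flat_apply (bonds : Finset (X × X)) (cb : X × X → ℝ) (hcb : ∀ b ∈ bonds, 0 ≤ cb b)
    (f : PiLp 2 (fun _ : X => ℝ)) (x : X) :
    lapL (flatT X) bonds cb f x = lap (wOf bonds cb) 0 (WithLp.ofLp f) x := by
  set g : X → ℝ := WithLp.ofLp f with hg
  have h1 : lapL (flatT X) bonds cb f x = ⟪lapL (flatT X) bonds cb f, EuclideanSpace.single x (1 : ℝ)⟫_ℝ := by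
    rw [EuclideanSpace.inner_single_right]
    simp
  rw [h1, inner_lapL_left, PiLp.inner_apply]
  have h2 : ∀ b : ↥bonds,
      ⟪DL (flatT X) bonds cb f b, DL (flatT X) bonds cb (EuclideanSpace.single x (1 : ℝ)) b⟫_ℝ
        = (if b.1.2 = x then cb b.1 * (g x - g b.1.1) else 0)
          + (if b.1.1 = x then cb b.1 * (g x - g b.1.2) else 0) := by
    intro b
    rw [DL_apply, DL_apply, covD_flatT, covD_flatT, real_inner_smul_left, real_inner_smul_right, ← mul_assoc,
      Real.mul_self_sqrt (hcb b.1 b.2)]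
    simp only [EuclideanSpace.single, PiLp.ofLp_single, Pi.single_apply, ← hg]
    rw [show ∀ u v : ℝ, ⟪u, v⟫_ℝ = v * u from fun u v => rfl]
    by_cases h2x : b.1.2 = x
    · by_cases h1x : b.1.1 = x
      · rw [if_pos h2x, if_pos h1x, if_pos h2x, if_pos h1x, h2x, h1x]; ring
      · rw [if_pos h2x, if_neg h1x, if_pos h2x, if_neg h1x, h2x]; ring
    · by_cases h1x : b.1.1 = x
      · rw [if_neg h2x, if_pos h1x, if_neg h2x, if_pos h1x, h1x]; ring
      · rw [if_neg h2x, if_neg h1x, if_neg h2x, if_neg h1x]; ring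
  rw [Finset.sum_congr rfl fun b _ => h2 b,
    Finset.sum_coe_sort bonds (fun b => (if b.2 = x then cb b * (g x - g b.1) else 0)
      + (if b.1 = x then cb b * (g x - g b.2) else 0)),
    Finset.sum_add_distrib, sum_bonds_snd bonds (fun b => cb b * (g x - g b.1)) x,
    sum_bonds_fst bonds (fun b => cb b * (g x - g b.2)) x, ← Finset.sum_add_distrib]
  unfold lap wOf
  rw [Pi.zero_apply, zero_mul, zero_add]
  refine Finset.sum_congr rfl fun z _ => ?_
  split_ifs <;> ring

/-! ## §3  The criterion and the two operators H′ on the lattice carriers -/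

/-- **Dictionary for the criterion**: «Δ maps N(Q′) into N(Q′)» on the (3.19)/(3.23) lattice carriers (flat, scalar,
uniform block weights κ ≠ 0 on the blocks of blk, bond weights c ≥ 0) ⟺ `B8Eq194Criterion.Crit (wOf bonds cb) 0 blk`.
[cite: Balaban1985BackgroundPropagators, (3.21)–(3.23) p. 394, (3.163)–(3.165) p. 429; Balaban1985RegularSpaces,
(1.91) p. 91] -/
theorem criterion_flat_iff (blk : X → Y) {κ : ℝ} (hκ : κ ≠ 0) (Γ : Y → X → List X)
    (y : Y → X) (bonds : Finset (X × X)) (cb : X × X → ℝ) (hcb : ∀ b ∈ bonds, 0 ≤ cb b) :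
    (∀ l : PiLp 2 (fun _ : X => ℝ), qL (flatT X) (fun _ _ => κ) (blocksOf blk) Γ y l = 0 →
        qL (flatT X) (fun _ _ => κ) (blocksOf blk) Γ y (lapL (flatT X) bonds cb l) = 0)
      ↔ Crit (wOf bonds cb) 0 blk := by
  have hlap : ∀ l : PiLp 2 (fun _ : X => ℝ),
      WithLp.ofLp (lapL (flatT X) bonds cb l) = lap (wOf bonds cb) 0 (WithLp.ofLp l) :=
    fun l => funext fun x => lapL_flat_apply bonds cb hcb l x
  constructor
  · intro h f hf
    have h1 := h (WithLp.toLp 2 f) ((qL_flat_eq_zero_iff blk hκ Γ y _).2 hf)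
    rw [qL_flat_eq_zero_iff blk hκ, hlap] at h1
    exact h1
  · intro h l hl
    rw [qL_flat_eq_zero_iff blk hκ] at hl ⊢
    rw [hlap]
    exact h _ hl

omit [DecidableEq Y] in
/-- The weight operator a = diag(a_c) of (3.24) is onto when every a_c ≠ 0 (print: a_c > 0).
[cite: Balaban1985BackgroundPropagators, (3.24) p. 394] -/
theorem AL_surjective (a : Y → ℝ) (ha : ∀ c, a c ≠ 0) : Function.Surjective (AL (V := ℝ) a) := by
  intro φ
  refine ⟨WithLp.toLp 2 (fun c => (a c)⁻¹ * WithLp.ofLp φ c), ?_⟩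
  ext c
  rw [AL_apply]
  show a c • ((a c)⁻¹ * WithLp.ofLp φ c) = WithLp.ofLp φ c
  rw [smul_eq_mul, ← mul_assoc, mul_inv_cancel₀ (ha c), one_mul]

variable [Fintype Y]

/-- **H′_{(4)} = H′_{(1.91)} ⟺ the scalar-model criterion**, for ANY (3.25)-data over the flat scalar lattice carriers
with a onto (combining `criterion_flat_iff` with gen 7's `H4_eq_Hp_of_criterion` / `criterion_of_H4_eq_Hp`).
[cite: Balaban1985RegularSpaces, (1.91) p. 91; Balaban1985BackgroundPropagators, (3.163)–(3.165) p. 429] -/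
theorem H4_eq_Hp_iff_crit (blk : X → Y) {κ : ℝ} (hκ : κ ≠ 0) (Γ : Y → X → List X) (y : Y → X)
    (bonds : Finset (X × X)) (cb : X × X → ℝ) (hcb : ∀ b ∈ bonds, 0 ≤ cb b)
    {A : PiLp 2 (fun _ : Y => ℝ) →ₗ[ℝ] PiLp 2 (fun _ : Y => ℝ)}
    {g : PiLp 2 (fun _ : X => ℝ) →ₗ[ℝ] PiLp 2 (fun _ : X => ℝ)}
    {c : PiLp 2 (fun _ : Y => ℝ) →ₗ[ℝ] PiLp 2 (fun _ : Y => ℝ)}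
    (hdata : Data (lapL (flatT X) bonds cb) (qL (flatT X) (fun _ _ => κ) (blocksOf blk) Γ y)
      (LinearMap.adjoint (qL (flatT X) (fun _ _ => κ) (blocksOf blk) Γ y)) A g c)
    (hA : Function.Surjective A) :
    (∀ μ, H4 (qL (flatT X) (fun _ _ => κ) (blocksOf blk) Γ y)
        (LinearMap.adjoint (qL (flatT X) (fun _ _ => κ) (blocksOf blk) Γ y)) A g c μ
        = Hp (LinearMap.adjoint (qL (flatT X) (fun _ _ => κ) (blocksOf blk) Γ y)) g c μ)
      ↔ Crit (wOf bonds cb) 0 blk :=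
  ⟨fun hH => (criterion_flat_iff blk hκ Γ y bonds cb hcb).1 (criterion_of_H4_eq_Hp hdata hA hH),
    fun hc μ => H4_eq_Hp_of_criterion hdata ((criterion_flat_iff blk hκ Γ y bonds cb hcb).2 hc) μ⟩

omit [DecidableEq X] in
/-- The (3.25)-data EXIST on the flat scalar lattice carriers for every block system with positive bond weights and
positive a_c (`B9Thm311Lattice.obvious_311_lattice` at τ = id).
[cite: Balaban1985BackgroundPropagators, (3.25) p. 394, Thm 3.11 p. 416] -/
theorem exists_data_flat (blk : X → Y) (κ : ℝ) {Γ : Y → X → List X} {y : Y → X} {bonds : Finset (X × X)}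
    (cb : X × X → ℝ) (hcb : ∀ b ∈ bonds, 0 < cb b) (hS : IsBlockSystem bonds (fun _ _ => κ) (blocksOf blk) Γ y)
    (a : Y → ℝ) (ha : ∀ c, 0 < a c) :
    ∃ (g : PiLp 2 (fun _ : X => ℝ) →ₗ[ℝ] PiLp 2 (fun _ : X => ℝ))
      (c : PiLp 2 (fun _ : Y => ℝ) →ₗ[ℝ] PiLp 2 (fun _ : Y => ℝ)),
      Data (lapL (flatT X) bonds cb) (qL (flatT X) (fun _ _ => κ) (blocksOf blk) Γ y)
        (LinearMap.adjoint (qL (flatT X) (fun _ _ => κ) (blocksOf blk) Γ y)) (AL a) g c := by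
  obtain ⟨g, c, hdata, -⟩ := obvious_311_lattice (flatT X) flatT_injective cb hcb hS a ha
  exact ⟨g, c, hdata⟩

/-- **If the scalar-model criterion fails, (1.91)'s H′ is NOT the operator of [4] (3.163)** — for every (3.25)-data
over the flat scalar lattice carriers (positive a_c); with parts 1–3 this upgrades the six-site witness of
`B8Eq194FirstTerm.Witness6` to all block systems violating `Crit`.
[cite: Balaban1985RegularSpaces, (1.91) p. 91; Balaban1985BackgroundPropagators, (3.163)–(3.165) p. 429] -/
theorem exists_Hp_ne_H4_of_not_crit (blk : X → Y) {κ : ℝ} (hκ : κ ≠ 0) (Γ : Y → X → List X) (y : Y → X)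
    (bonds : Finset (X × X)) (cb : X × X → ℝ) (hcb : ∀ b ∈ bonds, 0 ≤ cb b) (a : Y → ℝ) (ha : ∀ c, a c ≠ 0)
    (hnot : ¬ Crit (wOf bonds cb) 0 blk)
    {g : PiLp 2 (fun _ : X => ℝ) →ₗ[ℝ] PiLp 2 (fun _ : X => ℝ)}
    {c : PiLp 2 (fun _ : Y => ℝ) →ₗ[ℝ] PiLp 2 (fun _ : Y => ℝ)}
    (hdata : Data (lapL (flatT X) bonds cb) (qL (flatT X) (fun _ _ => κ) (blocksOf blk) Γ y)
      (LinearMap.adjoint (qL (flatT X) (fun _ _ => κ) (blocksOf blk) Γ y)) (AL a) g c) :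
    ∃ μ, Hp (LinearMap.adjoint (qL (flatT X) (fun _ _ => κ) (blocksOf blk) Γ y)) g c μ
      ≠ H4 (qL (flatT X) (fun _ _ => κ) (blocksOf blk) Γ y)
          (LinearMap.adjoint (qL (flatT X) (fun _ _ => κ) (blocksOf blk) Γ y)) (AL a) g c μ := by
  by_contra hall
  refine hnot ((H4_eq_Hp_iff_crit blk hκ Γ y bonds cb hcb hdata (AL_surjective a ha)).1 fun μ => ?_)
  by_contra hμ
  exact hall ⟨μ, fun h => hμ h.symm⟩

end

end Literature.MathematicalPhysics.QuantumFieldTheory.Balaban1983to89.B8Eq194CriterionLattice
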